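import Summits.RiemannHypothesis.RiemannHypothesis.Theorems.HandoffDodgerSmallPhi
import Summits.RiemannHypothesis.RiemannHypothesis.Theorems.HandoffDodgerProfileDefs
import HarnessLib

/-!
# HANDOFF — FIFTH SLAB (5): the profile value at `y = 27`, window `α = 12/25` (rh-explicit, W-P(P2) crux 19185, seat dodger-p2 gen0; DODGER-STAGE2-PLAN §2)

RH-FREE. HONEST FRAMING: nothing here bears on the truth of RH; part (5) of the discharge of the hypotheses of
`HandoffDodgerExplicitWindowCounting.dodger_witness_explicit_window_counting` on the fifth slab `1015 ≤ q < 7100` at the constant schedule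
`y = 27`, `α = 12/25`: the profile argument is the CONSTANT `x = (199α/100)²·y² = (2388/2500)²·729 = 664.87…`, so ONE partial sum
suffices — `Φ(x) ≥ Φ(664) ≥ Σ_{n ≤ 12} 664ⁿ/(n!(2n)!) ≥ 1.01·10⁶` (**`dodgerPhi_slabFive_ge`**); the per-sub-slab numeric comparison
`3450·B₂(B₂+1.17)·X < 0.0253·κ₀²·(1.01·10⁶)²` is then a `norm_num` fact in the assembly. This seat's `HandoffDodgerSlabFourPhi` re-constanted.

References: this track (ATTEMPT-16 §1, ATTEMPT-21 §6, ATTEMPT-23 §2/§7; HOME/rh-explicit-dodger-p2/DODGER-STAGE2-PLAN.md §2).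
-/

set_option linter.dupNamespace false

noncomputable section

open Real Finset

namespace Summit.RiemannHypothesis.RiemannHypothesis.Theorems.Handoff

/-- `Σ_{n ≤ 12} 664ⁿ/(n!(2n)!) ≥ 1.01·10⁶`. [this track, DODGER-STAGE2-PLAN §2] -/
theorem profileSum_ge_slabFive :
    (1010000 : ℝ) ≤ ∑ n ∈ range 13, (664 : ℝ) ^ n / ((n.factorial : ℝ) * ((2 * n).factorial : ℝ)) := by
  simp only [sum_range_succ, sum_range_zero, Nat.factorial]
  norm_num

/-- **Part (5) of the fifth-slab discharge: the profile value at `y = 27`, `α = 12/25`.**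
`1.01·10⁶ ≤ Φ((199·(12/25)/100)²·27²)` (`Φ = dodgerPhi`). [this track, DODGER-STAGE2-PLAN §2] -/
theorem dodgerPhi_slabFive_ge : (1010000 : ℝ) ≤ dodgerPhi ((199 * (12 / 25 : ℝ) / 100) ^ 2 * 27 ^ 2) := by
  have hS := profileSum_le_of_hasSum (by norm_num : (0 : ℝ) ≤ 664) (summable_dodgerPhiTerm 664).hasSum 13
  have h1 : (1010000 : ℝ) ≤ dodgerPhi 664 := profileSum_ge_slabFive.trans hS
  have h2 : dodgerPhi 664 ≤ dodgerPhi ((199 * (12 / 25 : ℝ) / 100) ^ 2 * 27 ^ 2) :=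
    dodgerPhi_le_dodgerPhi (by norm_num) (by norm_num)
  exact h1.trans h2

end Summit.RiemannHypothesis.RiemannHypothesis.Theorems.Handoff

end
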